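import Literature.AlgebraicGeometry.Motives.PicardQuarticFunctionFieldAlgEquiv
import Literature.AlgebraicGeometry.Motives.CurvePlaces
import Literature.AlgebraicGeometry.Motives.VarietiesProperProofs
import Literature.NumberTheory.GaloisRepresentations.DivisorClassGaloisAction
import HarnessLib

/-!
# The Picard quartic `y³ z = F(x, z)`: closed points ↔ places of `K(x)[y]/(y³ - g)`

Continuing `Motives/PicardQuarticFunctionFieldAlgEquiv` (`K(X_F) ≃ₐ[K] K(x)[y]/(y³ - g)` for the
smooth plane quartic `X_F = hypersurface (picardForm g)`, `g` separable of degree `4`, `3 ≠ 0`),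
this file identifies the **closed points of the projective curve `X_F`** with the **places of
the superelliptic function field `SuperellipticFunctionField K K 3 g = K(x)[y]/(y³ - g)`** of
`NumberTheory/GaloisRepresentations/SuperellipticFunctionField` — the dictionary between the
scheme `X_F` (where Jacobians / étale cohomology live) and the function-field model in which the
divisor class group `SuperellipticPic`, its Frobenius action and Tate module are defined
(`SuperellipticTorsionRep`, `PicardFrobeniusDegDet`).

* `CurvePlaces.placeComap e Q` — transport of a place along a `K`-algebra isomorphism of
  function fields `e : F₁ ≃ₐ[K] F₂`, `Q ↦ e⁻¹(𝒪_Q)` (Stichtenoth Lemma 3.5.2 for isomorphisms;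
  no `IsAlgFunctionField` hypothesis: `e⁻¹(𝒪_Q) ≅ 𝒪_Q` is a DVR by transport,
  Mathlib `IsDiscreteValuationRing.RingEquivClass.isDiscreteValuationRing`), and the bijection
  **`CurvePlaces.placeCongr e : PlaceOver K F₁ ≃ PlaceOver K F₂`**, `P ↦ e(𝒪_P)`, with
  `ord_{e P}(e x) = ord_P(x)` (`ord_placeCongr_apply`) and `deg (e P) = deg P` (`degree_placeCongr`).
* `PicardQuartic.isProper_hypersurface_picardForm`, `smoothOfRelativeDimension_hypersurface_picardForm`
  — `X_F → Spec K` is proper and smooth of relative dimension `1`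
  (`isSmoothProjective_hypersurface_picardForm` with `IsSmoothProjective.isProper_holds`).
* **`PicardQuartic.pointEquivPlace : {x : X_F // x ≠ η} ≃ PlaceOver K (K(x)[y]/(y³ - g))`** —
  `CurvePlaces.pointEquivPlace` (Hartshorne II.6 Lemma 6.5 / Cor. 6.6: closed points of a complete
  nonsingular curve ↔ discrete valuation rings of its function field) composed with `placeCongr`
  of `functionFieldAlgEquiv`; `mem_pointEquivPlace_iff`: `e φ ∈ 𝒪_{v(x)} ↔ φ` regular at `x`.

Everything is proved; no named facts (D-0026).

Mathlib searched (pin): `IsDiscreteValuationRing.RingEquivClass.isDiscreteValuationRing`, `ValuationSubring.comap`,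
`IsLocalRing.ResidueField.mapEquiv`, `AlgEquiv.ofRingEquiv`, `LinearEquiv.finrank_eq` (used);
no places-of-function-fields / points-of-curves dictionary in Mathlib.

## References

* R. Hartshorne, *Algebraic Geometry*, GTM 52 (1977), II.6 Lemma 6.5, Cor. 6.6 and I.6
  (abstract nonsingular curves = sets of DVRs of `K/k`). [Hartshorne1977]
* H. Stichtenoth, *Algebraic Function Fields and Codes*, 2nd ed., GTM 254 (2009), Lemma 3.5.2
  (isomorphisms transport places, valuations and degrees). [Stichtenoth2009]
-/

noncomputable section

universe u v w

open CategoryTheory AlgebraicGeometry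

namespace Literature.AlgebraicGeometry.Motives

open Literature.NumberTheory.DiophantineGeometry Literature.NumberTheory.DiophantineGeometry.AlgFunctionField
open Literature.NumberTheory.GaloisRepresentations

/-! ### Transport of places along a `K`-isomorphism of function fields -/

namespace CurvePlaces

section Transport

variable {K : Type u} [Field K] {F₁ : Type v} {F₂ : Type w} [Field F₁] [Field F₂] [Algebra K F₁] [Algebra K F₂]

/-- The ring isomorphism `e⁻¹(𝒪) ≃+* 𝒪` for a valuation subring `𝒪 ⊆ F₂` and a field
isomorphism `e : F₁ ≃ F₂`. [folklore] -/
def valuationSubringComapEquiv (e : F₁ ≃+* F₂) (O : ValuationSubring F₂) :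
    O.comap (e : F₁ →+* F₂) ≃+* O where
  toFun y := ⟨e y, y.2⟩
  invFun y := ⟨e.symm y, show e (e.symm y) ∈ O by rw [e.apply_symm_apply]; exact y.2⟩
  left_inv y := Subtype.ext (e.symm_apply_apply _)
  right_inv y := Subtype.ext (e.apply_symm_apply _)
  map_mul' y z := Subtype.ext (map_mul e _ _)
  map_add' y z := Subtype.ext (map_add e _ _)

/-- Unfolding `valuationSubringComapEquiv`. [folklore] -/
@[simp]
theorem coe_valuationSubringComapEquiv (e : F₁ ≃+* F₂) (O : ValuationSubring F₂) (y : O.comap (e : F₁ →+* F₂)) :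
    (valuationSubringComapEquiv e O y : F₂) = e y := rfl

/-- `e⁻¹(𝒪) ≠ F₁` for `𝒪 ≠ F₂`. [folklore] -/
theorem comap_ne_top (e : F₁ ≃+* F₂) {O : ValuationSubring F₂} (hO : O ≠ ⊤) : O.comap (e : F₁ →+* F₂) ≠ ⊤ := by
  intro h
  apply hO
  refine top_unique fun y _ => ?_
  obtain ⟨x, rfl⟩ := e.surjective y
  have : x ∈ O.comap (e : F₁ →+* F₂) := h ▸ ValuationSubring.mem_top x
  exact this

/-- **Transport of a place along a `K`-algebra isomorphism** `e : F₁ ≃ₐ[K] F₂` of function fields: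
the place `e⁻¹(Q)` of `F₁/K` with valuation ring `e⁻¹(𝒪_Q)` (Stichtenoth Lemma 3.5.2, stated there
for automorphisms; `e⁻¹(𝒪_Q) ≅ 𝒪_Q` is again a discrete valuation ring containing `K`).
[cite: Stichtenoth2009, Lemma 3.5.2] -/
def placeComap (e : F₁ ≃ₐ[K] F₂) (Q : PlaceOver K F₂) : PlaceOver K F₁ where
  toValuationSubring := Q.toValuationSubring.comap ((e : F₁ ≃+* F₂) : F₁ →+* F₂)
  ne_top := comap_ne_top (e : F₁ ≃+* F₂) Q.ne_top
  isDVR := IsDiscreteValuationRing.RingEquivClass.isDiscreteValuationRing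
    (valuationSubringComapEquiv (e : F₁ ≃+* F₂) Q.toValuationSubring).symm
  algebraMap_mem c := by
    change e (algebraMap K F₁ c) ∈ Q.toValuationSubring
    rw [AlgEquiv.commutes]
    exact Q.algebraMap_mem c

/-- Membership in the transported place (definitional). [folklore] -/
theorem mem_placeComap_iff (e : F₁ ≃ₐ[K] F₂) (Q : PlaceOver K F₂) (x : F₁) :
    x ∈ (placeComap e Q).toValuationSubring ↔ e x ∈ Q.toValuationSubring :=
  Iff.rfl

/-- `e⁻¹((e⁻¹)⁻¹(P)) = P`. [folklore] -/
@[simp]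
theorem placeComap_placeComap_symm (e : F₁ ≃ₐ[K] F₂) (P : PlaceOver K F₁) :
    placeComap e (placeComap e.symm P) = P := by
  apply PlaceOver.ext
  ext x
  change e.symm (e x) ∈ P.toValuationSubring ↔ _
  rw [e.symm_apply_apply]

/-- `(e⁻¹)⁻¹(e⁻¹(Q)) = Q`. [folklore] -/
@[simp]
theorem placeComap_symm_placeComap (e : F₁ ≃ₐ[K] F₂) (Q : PlaceOver K F₂) :
    placeComap e.symm (placeComap e Q) = Q := by
  apply PlaceOver.ext
  ext y
  change e (e.symm y) ∈ Q.toValuationSubring ↔ _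
  rw [e.apply_symm_apply]

/-- **Places of `K`-isomorphic function fields correspond**: `P ↦ e(P)` (valuation ring `e(𝒪_P)`)
is a bijection `PlaceOver K F₁ ≃ PlaceOver K F₂` with inverse `Q ↦ e⁻¹(Q)`
(Stichtenoth Lemma 3.5.2). [cite: Stichtenoth2009, Lemma 3.5.2] -/
def placeCongr (e : F₁ ≃ₐ[K] F₂) : PlaceOver K F₁ ≃ PlaceOver K F₂ where
  toFun := placeComap e.symm
  invFun := placeComap e
  left_inv := placeComap_placeComap_symm e
  right_inv := placeComap_symm_placeComap e

/-- Unfolding `placeCongr`. [folklore] -/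
theorem placeCongr_apply (e : F₁ ≃ₐ[K] F₂) (P : PlaceOver K F₁) : placeCongr e P = placeComap e.symm P := rfl

/-- Unfolding `placeCongr.symm`. [folklore] -/
theorem placeCongr_symm_apply (e : F₁ ≃ₐ[K] F₂) (Q : PlaceOver K F₂) : (placeCongr e).symm Q = placeComap e Q := rfl

/-- Membership in `𝒪_{e(P)}`: `y ∈ 𝒪_{e(P)} ↔ e⁻¹ y ∈ 𝒪_P`. [folklore] -/
theorem mem_placeCongr_iff (e : F₁ ≃ₐ[K] F₂) (P : PlaceOver K F₁) (y : F₂) :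
    y ∈ (placeCongr e P).toValuationSubring ↔ e.symm y ∈ P.toValuationSubring :=
  Iff.rfl

/-- `e x ∈ 𝒪_{e(P)} ↔ x ∈ 𝒪_P`. [folklore] -/
@[simp]
theorem map_mem_placeCongr_iff (e : F₁ ≃ₐ[K] F₂) (P : PlaceOver K F₁) (x : F₁) :
    e x ∈ (placeCongr e P).toValuationSubring ↔ x ∈ P.toValuationSubring := by
  rw [mem_placeCongr_iff, e.symm_apply_apply]

/-- **Transport of valuations**: `ord_{e⁻¹(Q)}(x) = ord_Q(e x)` (both branches of `ord` are
values of `addVal` on the isomorphic discrete valuation rings `e⁻¹(𝒪_Q) ≅ 𝒪_Q`).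
[cite: Stichtenoth2009, Lemma 3.5.2] -/
theorem ord_placeComap (e : F₁ ≃ₐ[K] F₂) (Q : PlaceOver K F₂) (x : F₁) :
    (placeComap e Q).ord x = Q.ord (e x) := by
  let eQ : (placeComap e Q).toValuationSubring ≃+* Q.toValuationSubring :=
    valuationSubringComapEquiv (e : F₁ ≃+* F₂) Q.toValuationSubring
  by_cases hx : x ∈ (placeComap e Q).toValuationSubring
  · have hex : e x ∈ Q.toValuationSubring := (mem_placeComap_iff e Q x).1 hx
    rw [PlaceOver.ord_of_mem _ hx, PlaceOver.ord_of_mem _ hex]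
    have key : (⟨e x, hex⟩ : Q.toValuationSubring) = eQ ⟨x, hx⟩ := rfl
    rw [key, addVal_map_ringEquiv]
  · have hex : e x ∉ Q.toValuationSubring := fun h => hx ((mem_placeComap_iff e Q x).2 h)
    rw [PlaceOver.ord_of_not_mem _ hx, PlaceOver.ord_of_not_mem _ hex]
    have hx' : x⁻¹ ∈ (placeComap e Q).toValuationSubring :=
      ((placeComap e Q).toValuationSubring.mem_or_inv_mem x).resolve_left hx
    have hex' : (e x)⁻¹ ∈ Q.toValuationSubring := (Q.toValuationSubring.mem_or_inv_mem _).resolve_left hex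
    have key : (⟨(e x)⁻¹, hex'⟩ : Q.toValuationSubring) = eQ ⟨x⁻¹, hx'⟩ := Subtype.ext (map_inv₀ e x).symm
    rw [key, addVal_map_ringEquiv]

/-- **`ord_{e(P)}(e x) = ord_P(x)`.** [cite: Stichtenoth2009, Lemma 3.5.2] -/
@[simp]
theorem ord_placeCongr_apply (e : F₁ ≃ₐ[K] F₂) (P : PlaceOver K F₁) (x : F₁) :
    (placeCongr e P).ord (e x) = P.ord x := by
  rw [placeCongr_apply, ord_placeComap, e.symm_apply_apply]

/-- `ord_{e(P)}(y) = ord_P(e⁻¹ y)`. [cite: Stichtenoth2009, Lemma 3.5.2] -/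
theorem ord_placeCongr (e : F₁ ≃ₐ[K] F₂) (P : PlaceOver K F₁) (y : F₂) :
    (placeCongr e P).ord y = P.ord (e.symm y) :=
  ord_placeComap e.symm P y

/-- The `K`-algebra isomorphism of residue fields `κ(e⁻¹ Q) ≃ₐ[K] κ(Q)` induced by
`e⁻¹(𝒪_Q) ≅ 𝒪_Q`. [folklore] -/
def residueFieldEquivOfPlaceComap (e : F₁ ≃ₐ[K] F₂) (Q : PlaceOver K F₂) :
    (placeComap e Q).residueField ≃ₐ[K] Q.residueField :=
  AlgEquiv.ofRingEquiv
    (f := IsLocalRing.ResidueField.mapEquiv (valuationSubringComapEquiv (e : F₁ ≃+* F₂) Q.toValuationSubring))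
    fun c => by
      rw [PlaceOver.algebraMap_residueField_apply, PlaceOver.algebraMap_residueField_apply]
      change IsLocalRing.ResidueField.map _ (IsLocalRing.residue _ _) = _
      rw [IsLocalRing.ResidueField.map_residue]
      congr 1
      apply Subtype.ext
      change e (algebraMap K F₁ c) = algebraMap K F₂ c
      exact e.commutes c

/-- **Transport preserves degrees**: `deg (e⁻¹ Q) = deg Q`. [cite: Stichtenoth2009, Lemma 3.5.2] -/
@[simp]
theorem degree_placeComap (e : F₁ ≃ₐ[K] F₂) (Q : PlaceOver K F₂) : (placeComap e Q).degree = Q.degree :=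
  (residueFieldEquivOfPlaceComap e Q).toLinearEquiv.finrank_eq

/-- **`deg (e P) = deg P`.** [cite: Stichtenoth2009, Lemma 3.5.2] -/
@[simp]
theorem degree_placeCongr (e : F₁ ≃ₐ[K] F₂) (P : PlaceOver K F₁) : (placeCongr e P).degree = P.degree :=
  degree_placeComap e.symm P

end Transport

end CurvePlaces

/-! ### Closed points of the Picard quartic and places of `K(x)[y]/(y³ - g)` -/

namespace PicardQuartic

open SmoothHypersurface CurvePlaces RatFn

variable {K : Type u} [Field K] {g : Polynomial K} (h3 : (3 : K) ≠ 0) (hsep : g.Separable) (hg : g.natDegree = 4)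

include h3 hsep hg in
/-- `X_F → Spec K` is proper (a smooth projective plane curve; `IsSmoothProjective.isProper_holds`).
[cite: Hartshorne1977, II.4.9] -/
theorem isProper_hypersurface_picardForm : IsProper (hypersurface (picardForm g)).hom :=
  IsSmoothProjective.isProper_holds (isSmoothProjective_hypersurface_picardForm h3 hg hsep)

include h3 hsep hg in
/-- `X_F → Spec K` is smooth of relative dimension `1` (the plane quartic `y³ z = F(x, z)` is
nonsingular for `f` a separable quartic and `3 ≠ 0`). [cite: Hartshorne1977, I Ex. 5.8 and II Example 3.2.6] -/
theorem smoothOfRelativeDimension_hypersurface_picardForm :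
    SmoothOfRelativeDimension 1 (hypersurface (picardForm g)).hom :=
  (isSmoothProjective_hypersurface_picardForm h3 hg hsep).smoothOfRelativeDimension

variable [Fact (Irreducible (superellipticPoly K K 3 g))] [IsIntegral (hypersurface (picardForm g)).left]

/-- **Closed points of the Picard quartic `X_F` ↔ places of `K(x)[y]/(y³ - g)`**: the closed
(= non-generic) point `x` goes to the place whose valuation ring is the image of `𝒪_{X_F,x}` under
`K(X_F) ≃ₐ[K] K(x)[y]/(y³ - g)` (Hartshorne II.6 Lemma 6.5 / Cor. 6.6 via
`CurvePlaces.pointEquivPlace`, transported along `functionFieldAlgEquiv`). Integrality of `X_F`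
(`isIntegral_hypersurface_picardForm`) is an instance hypothesis, as in `functionFieldEquiv`.
[cite: Hartshorne1977, II.6 Lemma 6.5 and Cor. 6.6] -/
def pointEquivPlace :
    {x : (hypersurface (picardForm g)).left // x ≠ genericPoint (hypersurface (picardForm g)).left} ≃
      PlaceOver K (SuperellipticFunctionField K K 3 g) :=
  haveI := smoothOfRelativeDimension_hypersurface_picardForm h3 hsep hg
  haveI := isProper_hypersurface_picardForm h3 hsep hg
  (CurvePlaces.pointEquivPlace (C := hypersurface (picardForm g))).trans (placeCongr (functionFieldAlgEquiv hsep hg))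

/-- Unfolding `pointEquivPlace`: it is `placeCongr e (place x)`. [folklore] -/
theorem pointEquivPlace_apply (x : {x : (hypersurface (picardForm g)).left // x ≠ genericPoint (hypersurface (picardForm g)).left}) :
    pointEquivPlace h3 hsep hg x =
      haveI := smoothOfRelativeDimension_hypersurface_picardForm h3 hsep hg
      placeCongr (functionFieldAlgEquiv hsep hg) (place (hypersurface (picardForm g)) x.1 x.2) := rfl

/-- **`e φ ∈ 𝒪_{v(x)} ↔ φ` is regular at `x`** for the place `v(x)` of the closed point `x` and the
field isomorphism `e = functionFieldAlgEquiv`. [cite: Hartshorne1977, II.6 Cor. 6.6] -/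
theorem map_mem_pointEquivPlace_iff
    (x : {x : (hypersurface (picardForm g)).left // x ≠ genericPoint (hypersurface (picardForm g)).left})
    (φ : (hypersurface (picardForm g)).left.functionField) :
    functionFieldAlgEquiv hsep hg φ ∈ (pointEquivPlace h3 hsep hg x).toValuationSubring ↔ IsRegularAt x.1 φ := by
  haveI := smoothOfRelativeDimension_hypersurface_picardForm h3 hsep hg
  rw [pointEquivPlace_apply, map_mem_placeCongr_iff]
  exact mem_place_iff x.2

/-- `ψ ∈ 𝒪_{v(x)} ↔ e⁻¹ ψ` is regular at `x`. [cite: Hartshorne1977, II.6 Cor. 6.6] -/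
theorem mem_pointEquivPlace_iff
    (x : {x : (hypersurface (picardForm g)).left // x ≠ genericPoint (hypersurface (picardForm g)).left})
    (ψ : SuperellipticFunctionField K K 3 g) :
    ψ ∈ (pointEquivPlace h3 hsep hg x).toValuationSubring ↔ IsRegularAt x.1 ((functionFieldAlgEquiv hsep hg).symm ψ) := by
  rw [← map_mem_pointEquivPlace_iff h3 hsep hg x, AlgEquiv.apply_symm_apply]

/-- **Every place of `K(x)[y]/(y³ - g)` is centred at a unique closed point of `X_F`.**
[cite: Hartshorne1977, II.6 Lemma 6.5 and Cor. 6.6] -/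
theorem existsUnique_pointEquivPlace_eq (Q : PlaceOver K (SuperellipticFunctionField K K 3 g)) :
    ∃! x : {x : (hypersurface (picardForm g)).left // x ≠ genericPoint (hypersurface (picardForm g)).left},
      pointEquivPlace h3 hsep hg x = Q :=
  (pointEquivPlace h3 hsep hg).bijective.existsUnique Q

end PicardQuartic

end Literature.AlgebraicGeometry.Motives
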